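import Summits.QuantumFields.YangMills.Theorems.CoarseStiffnessTailCappedCoarseStiffnessLPivotPeeling

/-!
# Route `CoarseStiffnessTail` — LATTICE STOKES FOR RECTANGLES: `|U(∂R) − 1| ≤ Σ_{p ∈ R} |U(∂p) − 1|`, and the commutator of two corner cycles
# (lead's certificate, seat `ym-line-cst-p1` g15; helper on 25301 `CappedCoarseStiffnessL`, stub S3 = uniform mean action, P2/(R2))

THE INEQUALITY (`dist1_rect_le`, any gauge group, any `Params`, any site `x`, directions `k ≠ l`, sizes `a, b`).  With the straight-line
holonomies `row_k(x, a) = Π_{i<a} U⟨x + i e_k, e_k⟩` and the boundary holonomy of the `a × b` rectangle based at `x`,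
`U(∂R) = row_k(x,a)·row_l(x + a e_k, b)·row_k(x + b e_l, a)⁻¹·row_l(x, b)⁻¹`, one has

  `|U(∂R) − 1| ≤ Σ_{i<a} Σ_{j<b} |U(∂p(x + i e_k + j e_l)) − 1|`,   `U(∂p(z)) = U⟨z,k⟩U⟨z+e_k,l⟩U⟨z+e_l,k⟩⁻¹U⟨z,l⟩⁻¹`.

PROOF (non-abelian Stokes as an inequality; `|·−1| = dist1` is subadditive and conjugation invariant).  Adding one plaquette on top of a `1 × b`
column multiplies the column's boundary holonomy on the LEFT by a conjugate of (a cyclic rotation of) the new plaquette holonomy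
(`column_succ`); adding one column to an `a × b` rectangle multiplies on the left by a conjugate of the column holonomy (`rect_succ`); each
step costs at most the `dist1` of the added piece (`dist1_conj_mul_le`).  The group identities are closed by `group` once the straight lines
are split (`List.range_succ`).

THE COROLLARY (`dist1_comm_cornerCycles_le`): on the torus (`n` sites per direction, `a = b = n`, `x = c*` the corner) the four straight lines
close up, `U(∂R) = h_k h_l h_k⁻¹ h_l⁻¹` for the corner CYCLES `h_k = Π_{i<n} U⟨c* + i e_k, e_k⟩`, so
`|[h_k, h_l] − 1| ≤ Σ_{i<n} Σ_{j<n} |U(∂p(c* + i e_k + j e_l)) − 1|` — the whole `(k,l)`-slice through the corner.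

WHY (line card §g15, P2).  The exact-exponent upper bound needs a functional of the FREE bonds of the corner-comb family dominated by the action:
the commutator defects of the corner cycles.  With `|W − 1|² ≤ 2N(1 − Re tr W)` and Cauchy–Schwarz over the `n²` plaquettes of a slice:
`1 − Re tr[h_k,h_l] ≤ N·n²·Σ_{slice}(1 − Re tr U(∂p))` (companion `…LSharpUpperBound`).

HONEST SCOPE.  Group algebra and `dist1` bookkeeping; nothing of Bałaban's is asserted; the crux 25301, its stubs S1/S2/S3, `HistoryTailL`
19936 stay OPEN; `YM3TorusSU2` (R3, RECORD rung, not Clay) is NOT proved; the Yang–Mills mass gap is NOT touched.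

References: I. Montvay, G. Münster, *Quantum Fields on a Lattice* (1994) §3.2.5 [MontvayMunster1994] (lattice Stokes / lassos);
T. Bałaban, CMP **98** (1985) 17–51 [Balaban1985Averaging] ((9) p.19, plaquette variables).
-/

noncomputable section

open scoped BigOperators

namespace Summit.QuantumFields.YangMills.Theorems.CoarseStiffnessTailLatticeStokes

open Literature.MathematicalPhysics.QuantumFieldTheory.Balaban1983to89

variable {G : Type*} [GaugeGroup G] (P : Params)

/-! ## §1 Site arithmetic and straight lines -/

section Lines

/-- `x + 0·e_k = x`. [folklore] -/
theorem update_add_zero (x : Site P 0) (k : Fin P.d) : Function.update x k (x k + ((0 : ℕ) : ZMod (P.sitesPerDir 0))) = x := by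
  simp

/-- `(x + i e_k) + e_k = x + (i+1) e_k`. [folklore] -/
theorem shift_update_add (x : Site P 0) (k : Fin P.d) (i : ℕ) :
    (Site.shift (Function.update x k (x k + (i : ZMod (P.sitesPerDir 0)))) k) =
      Function.update x k (x k + ((i + 1 : ℕ) : ZMod (P.sitesPerDir 0))) := by
  unfold Site.shift
  rw [Function.update_idem, Function.update_self]
  push_cast
  rw [add_assoc]

/-- `(x + a e_k) + e_l = (x + e_l) + a e_k` for `k ≠ l` (as iterated updates). [folklore] -/
theorem shift_update_comm (x : Site P 0) {k l : Fin P.d} (hkl : k ≠ l) (c : ZMod (P.sitesPerDir 0)) :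
    (Site.shift (Function.update x k c) l) = Function.update (x.shift l) k c := by
  unfold Site.shift
  rw [Function.update_of_ne hkl.symm, Function.update_comm hkl]

/-- Splitting the last bond off a straight line: `row_k(x, a+1) = row_k(x, a) · U⟨x + a e_k, e_k⟩`. [folklore] -/
theorem row_succ (U : GaugeField P 0 G) (x : Site P 0) (k : Fin P.d) (a : ℕ) :
    ((List.range (a + 1)).map fun i : ℕ => U ⟨Function.update x k (x k + (i : ZMod (P.sitesPerDir 0))), k⟩).prod =
      ((List.range a).map fun i : ℕ => U ⟨Function.update x k (x k + (i : ZMod (P.sitesPerDir 0))), k⟩).prod *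
        U ⟨Function.update x k (x k + (a : ZMod (P.sitesPerDir 0))), k⟩ := by
  rw [List.range_succ, List.map_append, List.prod_append, List.map_singleton, List.prod_singleton]

/-- `dist1(g·h·g⁻¹·W) ≤ dist1(h) + dist1(W)`. [folklore] -/
theorem dist1_conj_mul_le (g h W : G) : dist1 (g * h * g⁻¹ * W) ≤ dist1 h + dist1 W := by
  calc dist1 (g * h * g⁻¹ * W) ≤ dist1 (g * h * g⁻¹) + dist1 W := GaugeGroup.dist1_mul_le _ _
    _ = dist1 h + dist1 W := by rw [GaugeGroup.dist1_conj]

end Lines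

/-! ## §2 Columns: adding one plaquette -/

section Column

/-- **THE COLUMN STEP**: the boundary holonomy of the `1 × (b+1)` column based at `y` is (a conjugate of a rotation of) the top plaquette
holonomy times the boundary holonomy of the `1 × b` column. [folklore] -/
theorem column_succ (U : GaugeField P 0 G) (y : Site P 0) {k l : Fin P.d} (hkl : k ≠ l) (b : ℕ) :
    U ⟨y, k⟩ *
        ((List.range (b + 1)).map fun j : ℕ =>
          U ⟨Function.update (y.shift k) l ((y.shift k) l + (j : ZMod (P.sitesPerDir 0))), l⟩).prod *
        (U ⟨Function.update y l (y l + ((b + 1 : ℕ) : ZMod (P.sitesPerDir 0))), k⟩)⁻¹ *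
        (((List.range (b + 1)).map fun j : ℕ => U ⟨Function.update y l (y l + (j : ZMod (P.sitesPerDir 0))), l⟩).prod)⁻¹ =
      (U ⟨y, k⟩ * ((List.range b).map fun j : ℕ =>
          U ⟨Function.update (y.shift k) l ((y.shift k) l + (j : ZMod (P.sitesPerDir 0))), l⟩).prod) *
        ((U ⟨Function.update y l (y l + (b : ZMod (P.sitesPerDir 0))), k⟩)⁻¹ *
          (U ⟨Function.update y l (y l + (b : ZMod (P.sitesPerDir 0))), k⟩ *
            U ⟨(Site.shift (Function.update y l (y l + (b : ZMod (P.sitesPerDir 0)))) k), l⟩ *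
            (U ⟨(Site.shift (Function.update y l (y l + (b : ZMod (P.sitesPerDir 0)))) l), k⟩)⁻¹ *
            (U ⟨Function.update y l (y l + (b : ZMod (P.sitesPerDir 0))), l⟩)⁻¹) *
          U ⟨Function.update y l (y l + (b : ZMod (P.sitesPerDir 0))), k⟩) *
        (U ⟨y, k⟩ * ((List.range b).map fun j : ℕ =>
          U ⟨Function.update (y.shift k) l ((y.shift k) l + (j : ZMod (P.sitesPerDir 0))), l⟩).prod)⁻¹ *
      (U ⟨y, k⟩ *
        ((List.range b).map fun j : ℕ =>
          U ⟨Function.update (y.shift k) l ((y.shift k) l + (j : ZMod (P.sitesPerDir 0))), l⟩).prod *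
        (U ⟨Function.update y l (y l + (b : ZMod (P.sitesPerDir 0))), k⟩)⁻¹ *
        (((List.range b).map fun j : ℕ => U ⟨Function.update y l (y l + (j : ZMod (P.sitesPerDir 0))), l⟩).prod)⁻¹) := by
  rw [row_succ P U (y.shift k) l b, row_succ P U y l b]
  -- identify the two "new" sites with shifts of `z = y + b e_l`
  have hz1 : Function.update (y.shift k) l ((y.shift k) l + (b : ZMod (P.sitesPerDir 0))) =
      (Site.shift (Function.update y l (y l + (b : ZMod (P.sitesPerDir 0)))) k) := by
    rw [shift_update_comm P y hkl.symm]
    unfold Site.shift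
    rw [Function.update_of_ne hkl.symm]
  have hz2 : Function.update y l (y l + ((b + 1 : ℕ) : ZMod (P.sitesPerDir 0))) =
      (Site.shift (Function.update y l (y l + (b : ZMod (P.sitesPerDir 0)))) l) := (shift_update_add P y l b).symm
  rw [hz1, hz2]
  group

/-- **★ THE COLUMN INEQUALITY**: `|U(∂(1 × b column at y)) − 1| ≤ Σ_{j<b} |U(∂p(y + j e_l)) − 1|`. [folklore] -/
theorem dist1_column_le (U : GaugeField P 0 G) (y : Site P 0) {k l : Fin P.d} (hkl : k ≠ l) (b : ℕ) :
    dist1 (U ⟨y, k⟩ *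
        ((List.range b).map fun j : ℕ =>
          U ⟨Function.update (y.shift k) l ((y.shift k) l + (j : ZMod (P.sitesPerDir 0))), l⟩).prod *
        (U ⟨Function.update y l (y l + (b : ZMod (P.sitesPerDir 0))), k⟩)⁻¹ *
        (((List.range b).map fun j : ℕ => U ⟨Function.update y l (y l + (j : ZMod (P.sitesPerDir 0))), l⟩).prod)⁻¹) ≤
      ∑ j ∈ Finset.range b, dist1
        (U ⟨Function.update y l (y l + (j : ZMod (P.sitesPerDir 0))), k⟩ *
          U ⟨(Site.shift (Function.update y l (y l + (j : ZMod (P.sitesPerDir 0)))) k), l⟩ *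
          (U ⟨(Site.shift (Function.update y l (y l + (j : ZMod (P.sitesPerDir 0)))) l), k⟩)⁻¹ *
          (U ⟨Function.update y l (y l + (j : ZMod (P.sitesPerDir 0))), l⟩)⁻¹) := by
  induction b with
  | zero =>
    simp only [List.range_zero, List.map_nil, List.prod_nil, mul_one, inv_one, Finset.range_zero, Finset.sum_empty]
    rw [Nat.cast_zero, add_zero, Function.update_eq_self, mul_inv_cancel, GaugeGroup.dist1_one]
  | succ b ih =>
    rw [column_succ P U y hkl b, Finset.sum_range_succ]
    refine (dist1_conj_mul_le _ _ _).trans ?_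
    set u : G := U ⟨Function.update y l (y l + (b : ZMod (P.sitesPerDir 0))), k⟩ with hu
    set q : G := U ⟨Function.update y l (y l + (b : ZMod (P.sitesPerDir 0))), k⟩ *
          U ⟨(Site.shift (Function.update y l (y l + (b : ZMod (P.sitesPerDir 0)))) k), l⟩ *
          (U ⟨(Site.shift (Function.update y l (y l + (b : ZMod (P.sitesPerDir 0)))) l), k⟩)⁻¹ *
          (U ⟨Function.update y l (y l + (b : ZMod (P.sitesPerDir 0))), l⟩)⁻¹ with hq
    have hconj : dist1 (u⁻¹ * q * u) = dist1 q := by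
      rw [show u⁻¹ * q * u = u⁻¹ * q * u⁻¹⁻¹ by rw [inv_inv]]
      exact GaugeGroup.dist1_conj q u⁻¹
    rw [hconj]
    linarith [ih]

end Column

/-! ## §3 Rectangles: adding one column -/

section Rect

/-- **THE RECTANGLE STEP**: `U(∂R(a+1, b)) = row_k(x,a)·U(∂ column at x + a e_k)·row_k(x,a)⁻¹ · U(∂R(a,b))`. [folklore] -/
theorem rect_succ (U : GaugeField P 0 G) (x : Site P 0) {k l : Fin P.d} (hkl : k ≠ l) (a b : ℕ) :
    ((List.range (a + 1)).map fun i : ℕ => U ⟨Function.update x k (x k + (i : ZMod (P.sitesPerDir 0))), k⟩).prod *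
        ((List.range b).map fun j : ℕ =>
          U ⟨Function.update (Function.update x k (x k + ((a + 1 : ℕ) : ZMod (P.sitesPerDir 0)))) l
            (x l + (j : ZMod (P.sitesPerDir 0))), l⟩).prod *
        (((List.range (a + 1)).map fun i : ℕ =>
          U ⟨Function.update (Function.update x l (x l + (b : ZMod (P.sitesPerDir 0)))) k
            (x k + (i : ZMod (P.sitesPerDir 0))), k⟩).prod)⁻¹ *
        (((List.range b).map fun j : ℕ => U ⟨Function.update x l (x l + (j : ZMod (P.sitesPerDir 0))), l⟩).prod)⁻¹ =
      ((List.range a).map fun i : ℕ => U ⟨Function.update x k (x k + (i : ZMod (P.sitesPerDir 0))), k⟩).prod *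
        (U ⟨Function.update x k (x k + (a : ZMod (P.sitesPerDir 0))), k⟩ *
          ((List.range b).map fun j : ℕ =>
            U ⟨Function.update (Site.shift (Function.update x k (x k + (a : ZMod (P.sitesPerDir 0)))) k) l
              ((Site.shift (Function.update x k (x k + (a : ZMod (P.sitesPerDir 0)))) k) l + (j : ZMod (P.sitesPerDir 0))), l⟩).prod *
          (U ⟨Function.update (Function.update x k (x k + (a : ZMod (P.sitesPerDir 0)))) l
            ((Function.update x k (x k + (a : ZMod (P.sitesPerDir 0)))) l + (b : ZMod (P.sitesPerDir 0))), k⟩)⁻¹ *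
          (((List.range b).map fun j : ℕ =>
            U ⟨Function.update (Function.update x k (x k + (a : ZMod (P.sitesPerDir 0)))) l
              ((Function.update x k (x k + (a : ZMod (P.sitesPerDir 0)))) l + (j : ZMod (P.sitesPerDir 0))), l⟩).prod)⁻¹) *
        (((List.range a).map fun i : ℕ => U ⟨Function.update x k (x k + (i : ZMod (P.sitesPerDir 0))), k⟩).prod)⁻¹ *
      (((List.range a).map fun i : ℕ => U ⟨Function.update x k (x k + (i : ZMod (P.sitesPerDir 0))), k⟩).prod *
        ((List.range b).map fun j : ℕ =>
          U ⟨Function.update (Function.update x k (x k + (a : ZMod (P.sitesPerDir 0)))) l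
            (x l + (j : ZMod (P.sitesPerDir 0))), l⟩).prod *
        (((List.range a).map fun i : ℕ =>
          U ⟨Function.update (Function.update x l (x l + (b : ZMod (P.sitesPerDir 0)))) k
            (x k + (i : ZMod (P.sitesPerDir 0))), k⟩).prod)⁻¹ *
        (((List.range b).map fun j : ℕ => U ⟨Function.update x l (x l + (j : ZMod (P.sitesPerDir 0))), l⟩).prod)⁻¹) := by
  rw [row_succ P U x k a]
  -- the `k`-line at height `b`, split: its points are `(x + b e_l) + i e_k`
  have hrow : ((List.range (a + 1)).map fun i : ℕ =>
      U ⟨Function.update (Function.update x l (x l + (b : ZMod (P.sitesPerDir 0)))) k (x k + (i : ZMod (P.sitesPerDir 0))), k⟩).prod =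
      ((List.range a).map fun i : ℕ =>
        U ⟨Function.update (Function.update x l (x l + (b : ZMod (P.sitesPerDir 0)))) k (x k + (i : ZMod (P.sitesPerDir 0))), k⟩).prod *
      U ⟨Function.update (Function.update x l (x l + (b : ZMod (P.sitesPerDir 0)))) k (x k + (a : ZMod (P.sitesPerDir 0))), k⟩ := by
    have h := row_succ P U (Function.update x l (x l + (b : ZMod (P.sitesPerDir 0)))) k a
    simp only [Function.update_of_ne hkl] at h
    exact h
  rw [hrow]
  -- the three site identities
  have hs1 : (Site.shift (Function.update x k (x k + (a : ZMod (P.sitesPerDir 0)))) k) =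
      Function.update x k (x k + ((a + 1 : ℕ) : ZMod (P.sitesPerDir 0))) := shift_update_add P x k a
  have hs2 : (Site.shift (Function.update x k (x k + (a : ZMod (P.sitesPerDir 0)))) k) l = x l := by
    rw [hs1, Function.update_of_ne hkl.symm]
  have hs3 : (Function.update x k (x k + (a : ZMod (P.sitesPerDir 0)))) l = x l := Function.update_of_ne hkl.symm _ _
  have hs4 : Function.update (Function.update x k (x k + (a : ZMod (P.sitesPerDir 0)))) l (x l + (b : ZMod (P.sitesPerDir 0))) =
      Function.update (Function.update x l (x l + (b : ZMod (P.sitesPerDir 0)))) k (x k + (a : ZMod (P.sitesPerDir 0))) :=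
    Function.update_comm hkl _ _ _
  simp only [hs2, hs3]
  rw [hs1, hs4]
  group

/-- **★★ LATTICE STOKES FOR RECTANGLES**: for `k ≠ l` and every `a, b`,
`|U(∂R(a,b)) − 1| ≤ Σ_{i<a} Σ_{j<b} |U(∂p(x + i e_k + j e_l)) − 1|`. [folklore] -/
theorem dist1_rect_le (U : GaugeField P 0 G) (x : Site P 0) {k l : Fin P.d} (hkl : k ≠ l) (a b : ℕ) :
    dist1 (((List.range a).map fun i : ℕ => U ⟨Function.update x k (x k + (i : ZMod (P.sitesPerDir 0))), k⟩).prod *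
        ((List.range b).map fun j : ℕ =>
          U ⟨Function.update (Function.update x k (x k + (a : ZMod (P.sitesPerDir 0)))) l
            (x l + (j : ZMod (P.sitesPerDir 0))), l⟩).prod *
        (((List.range a).map fun i : ℕ =>
          U ⟨Function.update (Function.update x l (x l + (b : ZMod (P.sitesPerDir 0)))) k
            (x k + (i : ZMod (P.sitesPerDir 0))), k⟩).prod)⁻¹ *
        (((List.range b).map fun j : ℕ => U ⟨Function.update x l (x l + (j : ZMod (P.sitesPerDir 0))), l⟩).prod)⁻¹) ≤
      ∑ i ∈ Finset.range a, ∑ j ∈ Finset.range b, dist1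
        (U ⟨Function.update (Function.update x k (x k + (i : ZMod (P.sitesPerDir 0)))) l (x l + (j : ZMod (P.sitesPerDir 0))), k⟩ *
          U ⟨Site.shift (Function.update (Function.update x k (x k + (i : ZMod (P.sitesPerDir 0)))) l
            (x l + (j : ZMod (P.sitesPerDir 0)))) k, l⟩ *
          (U ⟨Site.shift (Function.update (Function.update x k (x k + (i : ZMod (P.sitesPerDir 0)))) l
            (x l + (j : ZMod (P.sitesPerDir 0)))) l, k⟩)⁻¹ *
          (U ⟨Function.update (Function.update x k (x k + (i : ZMod (P.sitesPerDir 0)))) l (x l + (j : ZMod (P.sitesPerDir 0))), l⟩)⁻¹) := by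
  induction a with
  | zero =>
    simp only [List.range_zero, List.map_nil, List.prod_nil, one_mul, inv_one, mul_one, Finset.range_zero, Finset.sum_empty,
      Nat.cast_zero, add_zero, Function.update_eq_self, mul_inv_cancel, GaugeGroup.dist1_one, le_refl]
  | succ a ih =>
    rw [rect_succ P U x hkl a b, Finset.sum_range_succ]
    refine (dist1_conj_mul_le _ _ _).trans ?_
    have hcol := dist1_column_le P U (Function.update x k (x k + (a : ZMod (P.sitesPerDir 0)))) hkl b
    have hs3 : (Function.update x k (x k + (a : ZMod (P.sitesPerDir 0)))) l = x l := Function.update_of_ne hkl.symm _ _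
    simp only [hs3] at hcol ⊢
    linarith [hcol, ih]

end Rect

/-! ## §4 On the torus: the commutator of two corner cycles -/

section Torus

/-- Going once around: `x + n·e_k = x` on the torus with `n` sites per direction. [folklore] -/
theorem update_add_sitesPerDir (x : Site P 0) (k : Fin P.d) :
    Function.update x k (x k + ((P.sitesPerDir 0 : ℕ) : ZMod (P.sitesPerDir 0))) = x := by
  rw [ZMod.natCast_self, add_zero, Function.update_eq_self]

/-- **★★ THE COMMUTATOR OF TWO CORNER CYCLES IS BOUNDED BY ITS TORUS SLICE**: for the cycles `h_k = Π_{i<n} U⟨x + i e_k, e_k⟩`,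
`h_l = Π_{j<n} U⟨x + j e_l, e_l⟩` through any site `x` (`k ≠ l`):
`|h_k h_l h_k⁻¹ h_l⁻¹ − 1| ≤ Σ_{i<n} Σ_{j<n} |U(∂p(x + i e_k + j e_l)) − 1|`. [folklore] -/
theorem dist1_comm_cycles_le (U : GaugeField P 0 G) (x : Site P 0) {k l : Fin P.d} (hkl : k ≠ l) :
    dist1 (((List.range (P.sitesPerDir 0)).map fun i : ℕ => U ⟨Function.update x k (x k + (i : ZMod (P.sitesPerDir 0))), k⟩).prod *
        ((List.range (P.sitesPerDir 0)).map fun j : ℕ => U ⟨Function.update x l (x l + (j : ZMod (P.sitesPerDir 0))), l⟩).prod *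
        (((List.range (P.sitesPerDir 0)).map fun i : ℕ => U ⟨Function.update x k (x k + (i : ZMod (P.sitesPerDir 0))), k⟩).prod)⁻¹ *
        (((List.range (P.sitesPerDir 0)).map fun j : ℕ => U ⟨Function.update x l (x l + (j : ZMod (P.sitesPerDir 0))), l⟩).prod)⁻¹) ≤
      ∑ i ∈ Finset.range (P.sitesPerDir 0), ∑ j ∈ Finset.range (P.sitesPerDir 0), dist1
        (U ⟨Function.update (Function.update x k (x k + (i : ZMod (P.sitesPerDir 0)))) l (x l + (j : ZMod (P.sitesPerDir 0))), k⟩ *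
          U ⟨Site.shift (Function.update (Function.update x k (x k + (i : ZMod (P.sitesPerDir 0)))) l
            (x l + (j : ZMod (P.sitesPerDir 0)))) k, l⟩ *
          (U ⟨Site.shift (Function.update (Function.update x k (x k + (i : ZMod (P.sitesPerDir 0)))) l
            (x l + (j : ZMod (P.sitesPerDir 0)))) l, k⟩)⁻¹ *
          (U ⟨Function.update (Function.update x k (x k + (i : ZMod (P.sitesPerDir 0)))) l (x l + (j : ZMod (P.sitesPerDir 0))), l⟩)⁻¹) := by
  have h := dist1_rect_le P U x hkl (P.sitesPerDir 0) (P.sitesPerDir 0)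
  rw [update_add_sitesPerDir P x k, update_add_sitesPerDir P x l] at h
  exact h

end Torus

end Summit.QuantumFields.YangMills.Theorems.CoarseStiffnessTailLatticeStokes

end
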